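import Mathlib
import Summits.Ventures.PercRepro.TriangleCapRowTopLayers

/-!
# PercRepro — THE BOTTOM OF A TRUNCATED BAND: THE EQUALITY CASE OF THE TANGENT-LINE BOUND (p3, gen 51; part 242)

At the extremal value `2 j + 2 q t = 2 t + t (t − 1) + ℓ q (q + 1)` of part 236's bound every inequality is tight:
no off-edge meets `N(w)` (`attach = 0`), no two off-edges share a vertex outside `L` (every vertex off `L ∪ {w}`
carries at most one off-edge), and every left vertex carries `q` or `q + 1` off-edges — the balanced distribution
(`tangent_eq_cases`: `c (c − 1) + q (q + 1) = 2 q c` iff `c ∈ {q, q + 1}`).  Triangle-free form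
`band_bottom_of_left_ends_eq`, cell form `cherry_row_band_bottom_locus` (`q = ⌊t / (a − 1)⌋`, the value
`j = t + C(t, 2) − (a − 1) C(q, 2) − ρ q` of part 239).  Axioms: standard.
-/

namespace PercRepro

namespace TriangleCap

namespace C047

open Finset

variable {V : Type*} [Fintype V] [DecidableEq V]

/-- The equality case of the tangent-line bound: `c (c − 1) + q (q + 1) = 2 q c` iff `c = q` or `c = q + 1`. -/
theorem tangent_eq_cases (c q : ℕ) (h : c * (c - 1) + q * (q + 1) = 2 * q * c) : c = q ∨ c = q + 1 := by
  rcases Nat.eq_zero_or_pos c with rfl | hc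
  · simp at h
    left
    nlinarith
  · obtain ⟨c', rfl⟩ : ∃ c', c = c' + 1 := ⟨c - 1, by omega⟩
    rw [Nat.add_sub_cancel] at h
    rcases Nat.lt_or_ge c' q with h1 | h1
    · obtain ⟨d, rfl⟩ : ∃ d, q = c' + 1 + d := ⟨q - c' - 1, by omega⟩
      have hd : d + d * d = 0 := by nlinarith [h]
      left
      omega
    · obtain ⟨d, rfl⟩ : ∃ d, c' = q + d := ⟨c' - q, by omega⟩
      have hd : d + d * d = 0 := by nlinarith [h]
      right
      omega

/-- **THE EQUALITY CASE OF THE BAND BOUND** (triangle-free form): at a vertex `w` with `t` off-edges each meeting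
`L` (`w ∉ L`) exactly once, at the band value `2 t (s − t − 1) + 2 j` with `2 j + 2 q t = 2 t + t (t − 1) + |L| q (q + 1)`:
`attach H w = 0`, every vertex off `L ∪ {w}` carries at most one off-edge, and every `x ∈ L` carries `q` or `q + 1`. -/
theorem band_bottom_of_left_ends_eq (H : SimpleGraph V) [DecidableRel H.Adj] (s t j : ℕ) (hm : H.edgeFinset.card = s)
    (w : V) (hw : 1 ≤ deg H w) (ht : (offEdges H w).card = t) (L : Finset V) (hwL : w ∉ L)
    (hL : ∀ e ∈ offEdges H w, (L.filter (fun x => x ∈ e)).card = 1)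
    (hS : ∑ v, deg H v * deg H v + 2 * (t * (s - t - 1)) + 2 * j = s * (s + 1)) (q : ℕ)
    (heq : 2 * j + 2 * q * t = 2 * t + t * (t - 1) + L.card * (q * (q + 1))) :
    attach H w = 0 ∧ (∀ v, v ∉ L → v ≠ w → offDeg H w v ≤ 1) ∧
      ∀ x ∈ L, offDeg H w x = q ∨ offDeg H w x = q + 1 := by
  have hkey := (layer_value_iff H s t j hm w hw ht).mp hS
  have ett : t * (t + 1) = t * (t - 1) + 2 * t := by
    rcases Nat.eq_zero_or_pos t with rfl | hpos
    · rfl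
    · obtain ⟨t', rfl⟩ : ∃ t', t = t' + 1 := ⟨t - 1, by omega⟩
      rw [Nat.add_sub_cancel]
      ring
  have hsum := sum_offDeg_eq_card_of_once H w L hL
  rw [ht] at hsum
  -- `offAdjPairs` as the sum over `univ.erase w`, split into `L` and the rest
  have hPsum := sum_erase_offDeg_mul_pred H w
  have hLsub : L ⊆ univ.erase w := fun x hx => mem_erase.mpr ⟨fun h => hwL (h ▸ hx), mem_univ x⟩
  have hsplit := sum_sdiff hLsub (f := fun v => offDeg H w v * (offDeg H w v - 1))
  have htan : ∀ x ∈ L, 2 * q * offDeg H w x ≤ offDeg H w x * (offDeg H w x - 1) + q * (q + 1) :=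
    fun x _ => two_mul_le_mul_pred_add _ q
  have hsum2 := sum_le_sum htan
  rw [sum_add_distrib, sum_const, smul_eq_mul, ← mul_sum, hsum] at hsum2
  have hrest0 : ∑ v ∈ (univ.erase w) \ L, offDeg H w v * (offDeg H w v - 1) = 0 := by omega
  have hA0 : attach H w = 0 := by omega
  have htight : ∑ x ∈ L, (offDeg H w x * (offDeg H w x - 1) + q * (q + 1)) = ∑ x ∈ L, 2 * q * offDeg H w x := by
    rw [sum_add_distrib, sum_const, smul_eq_mul, ← mul_sum, hsum]
    omega
  refine ⟨hA0, ?_, ?_⟩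
  · intro v hvL hvw
    rw [sum_eq_zero_iff] at hrest0
    have := hrest0 v (mem_sdiff.mpr ⟨mem_erase.mpr ⟨hvw, mem_univ v⟩, hvL⟩)
    rcases Nat.eq_zero_or_pos (offDeg H w v) with h0 | hpos
    · omega
    · obtain ⟨c, hc⟩ : ∃ c, offDeg H w v = c + 1 := ⟨offDeg H w v - 1, by omega⟩
      rw [hc, Nat.add_sub_cancel] at this
      have : c = 0 := by
        rcases Nat.eq_zero_or_pos c with rfl | hcpos
        · rfl
        · exfalso
          have := Nat.mul_pos (by omega : 0 < c + 1) hcpos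
          omega
      omega
  · intro x hx
    -- every tangent term is tight: the sum of the nonnegative differences vanishes
    have hdiff : ∑ x ∈ L, (offDeg H w x * (offDeg H w x - 1) + q * (q + 1) - 2 * q * offDeg H w x) = 0 := by
      rw [sum_tsub_distrib _ htan, htight, Nat.sub_self]
    rw [sum_eq_zero_iff] at hdiff
    have h1 := hdiff x hx
    have h2 := htan x hx
    exact tangent_eq_cases _ q (by omega)

/-- **THE BOTTOM OF THE TRUNCATED BAND ON THE CELL** (the hypotheses of `cherry_row_band_exact`, `q = ⌊t / (a − 1)⌋`,
and the extremal value `2 j + 2 q t = 2 t + t (t − 1) + (a − 1) q (q + 1)`): the graph is `a`-bipartite with a left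
star centre `w` of missing degree `r − t`; its `t` missing off-pairs avoid the star's leaves (`attach = 0`), no two of
them share a right vertex, and the left vertices other than `w` carry `q` or `q + 1` of them each — the balanced
distribution. -/
theorem cherry_row_band_bottom_locus (k a r t : ℕ) (ha3 : 3 ≤ a) (ht : 1 ≤ t) (hr4 : 4 * t + 3 ≤ r)
    (hr : 4 * t + 6 + t * (t + 1) ≤ 2 * r) (hat : a + t < r) (hk : 2 * a + r ≤ k) (hk3 : a = 3 → r + 7 ≤ k)
    (hlt : 2 * (t * (r - t - 1)) + t * (t + 1) < stabGapFull k a r) (j : ℕ) (hj : 2 * j ≤ t * (t + 1))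
    (hjq : 2 * j + 2 * (t / (a - 1)) * t = 2 * t + t * (t - 1) + (a - 1) * ((t / (a - 1)) * (t / (a - 1) + 1)))
    (D : SimpleGraph (Fin k)) [DecidableRel D.Adj] (hK : K4mFree D) (hm : D.edgeFinset.card + r = a * (k - a))
    (heq : ∑ v, deg D v * deg D v + r * (k - 1 - r) + (2 * (t * (r - t - 1)) + 2 * j) = D.edgeFinset.card * k) :
    ∃ A : Finset (Fin k), A.card = a ∧ BipSub D A ∧
      ∃ w, w ∈ A ∧ deg (missingGraph D A) w + t = r ∧ attach (missingGraph D A) w = 0 ∧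
        (∀ v, v ∉ A → v ≠ w → offDeg (missingGraph D A) w v ≤ 1) ∧
        ∀ x ∈ A.erase w, offDeg (missingGraph D A) w x = t / (a - 1) ∨
          offDeg (missingGraph D A) w x = t / (a - 1) + 1 := by
  obtain ⟨A, hA, hB, w, hw, hoff, -⟩ :=
    cherry_band_locus_level k a r t ha3 ht hr hr4 hk hk3 j hj (by omega) D hK hm heq
  have hcard : Fintype.card (Fin k) = k := Fintype.card_fin k
  have hwA : w ∈ A := by
    by_contra hwA
    have h1 := deg_add_deg_missingGraph D A hB w
    rw [if_neg hwA, hA] at h1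
    omega
  refine ⟨A, hA, hB, w, hwA, hw, ?_⟩
  have hH := bipSub_sum_deg_sq_add_disjEdgePairs D A hB a r hA (by rw [hcard]; exact hm) (by rw [hcard]; omega)
  rw [hcard] at hH
  have hr' : (missingGraph D A).edgeFinset.card = r :=
    card_edges_missingGraph D A hB a r hA (by rw [hcard]; exact hm)
  have hid := sum_deg_sq_add_disjEdgePairs (missingGraph D A)
  rw [hr'] at hid
  have hS : ∑ v, deg (missingGraph D A) v * deg (missingGraph D A) v + 2 * (t * (r - t - 1)) + 2 * j =
      r * (r + 1) := by
    omega
  -- every missing off-pair meets `A ∖ {w}` exactly once (as in part 236)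
  have hL : ∀ e ∈ offEdges (missingGraph D A) w, ((A.erase w).filter (fun x => x ∈ e)).card = 1 := by
    intro e he
    rw [mem_offEdges, SimpleGraph.mem_edgeFinset] at he
    obtain ⟨he, hwe⟩ := he
    revert he hwe
    refine Sym2.ind (fun x y he hwe => ?_) e
    rw [SimpleGraph.mem_edgeSet, missingGraph_adj] at he
    rw [Sym2.mem_iff] at hwe
    rw [card_eq_one]
    by_cases hx : x ∈ A
    · refine ⟨x, ?_⟩
      ext z
      simp only [mem_filter, mem_erase, Sym2.mem_iff, mem_singleton]
      constructor
      · rintro ⟨⟨hzw, hzA⟩, hz | hz⟩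
        · exact hz
        · exfalso
          subst hz
          exact (he.1.mp hx) hzA
      · rintro rfl
        exact ⟨⟨fun h => hwe (Or.inl h.symm), hx⟩, Or.inl rfl⟩
    · have hy : y ∈ A := by
        by_contra hy
        exact hx (he.1.mpr hy)
      refine ⟨y, ?_⟩
      ext z
      simp only [mem_filter, mem_erase, Sym2.mem_iff, mem_singleton]
      constructor
      · rintro ⟨⟨hzw, hzA⟩, hz | hz⟩
        · exfalso
          subst hz
          exact hx hzA
        · exact hz
      · rintro rfl
        exact ⟨⟨fun h => hwe (Or.inr h.symm), hy⟩, Or.inr rfl⟩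
  have h := band_bottom_of_left_ends_eq (missingGraph D A) r t j hr' w (by omega) hoff (A.erase w)
    (notMem_erase w A) hL hS (t / (a - 1)) (by rw [card_erase_of_mem hwA, hA]; exact hjq)
  obtain ⟨h1, h2, h3⟩ := h
  refine ⟨h1, fun v hvA hvw => h2 v (fun h => hvA (mem_erase.mp h).2) hvw, h3⟩

end C047

end TriangleCap

end PercRepro
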